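import HarnessLib
import Summits.ValiantsHypothesis.ValiantsHypothesis.Theorems.Depth4SymWidthNewtonGirard
import Literature.Computability.AlgebraicComplexity.StandardFamilies
import Mathlib.Data.Fintype.EquivFin
import Mathlib.Logic.Equiv.Defs

/-!
# Depth4SymWidthDet — the SYMMETRIC WIDTH DOOR: the determinant's square-symmetric composition at
door parameters (O30-C, decomp-valiant lens 4 «depth-reduction / chasm axis», generation 39; file 2 of 2)

LABEL «O30-C: det CALIBRATION in the square-symmetric sub-model · ELEMENTARY (bundled Newton–Girard) ·
NEW-REACH positive instance (DPS26 Outlook) · separating per/det at the door's own parameters GIVEN DW71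
(PROVED in tree; conversion = paper) · D-sensitive (paper) · 0 S-currency · closes NO item · NO C1
currency — nothing claimed for the unrestricted WidthDoor leaf; C1 tags / leaf UNCHANGED».

det CALIBRATION in the square-symmetric sub-model · ELEMENTARY (bundled Newton–Girard) · NEW-REACH
positive instance, not a method · 0 S-currency · closes NO item · NO C1 currency: nothing is claimed for
the unrestricted width door (×n! symmetrisation gap) · per side = corollary of Dawar–Wilsenach Thm 7.1
(PROVED in the tree: DawarWilsenach2025_thm71_holds) via the stable-composition ⇒ square-symmetric-circuit
conversion, NOT built here · VP ≠ VNP untouched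

HONEST BOUNDARY.  `VP ≠ VNP` is NOT proved and nothing here moves it.  The route's last crux
(`Depth4.Depth4HomFour`, stmt-ValiantsHypothesis-11333) and the width-door leaf of record (`WidthDoor`:
`Depth4WidthDoor.valiantsHypothesis_of_widthDoor`) are untouched and NOT claimed in any direction; this
file closes NO item and carries 0 S-currency.  What it does: it types the SQUARE-SYMMETRIC restriction of
the width door — compositions `f = F(Q₁,…,Q_w)` (`deg F ≤ D`, `deg Qᵢ ≤ t`) whose alphabet is STABLE
under the diagonal relabelling `x_pq ↦ x_{σp,σq}` (`σ ∈ Sym_n` acting through a permutation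
representation `π` on the letters) — and proves that in this sub-model the DETERMINANT passes the door:
`hasStableComp_detPoly : HasStableComp n ((n+2)^7) (7⌊√n⌋+7) ⌊√n⌋ det_n` for EVERY `n`, hence
`not_symWidthDoorOf_detPoly`.  `symWidthDoor_of_widthDoor` records that the width door of record implies
the symmetric one for the permanent (a stable composition is a composition).  The permanent's side
(the symmetric door HOLDS for per) is a paper corollary of Dawar–Wilsenach Thm 7.1 — PROVED in the tree
(`DawarWilsenach2025_thm71_holds`) — through the conversion «stable composition ⇒ square-symmetric circuit
of size `(n+w+D+t+2)^{O(D+t)}`», NOT built here; the per/det SEPARATION by the symmetric door is stated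
only in this docstring.  Nothing transfers to the unrestricted width door (symmetrising costs `n!`).

THE CONSTRUCTION (all `n ≥ 1`; the only small-`n` branch is `n = 0`, where `det = 1` and the trivial
composition `π = 1, Q = 0, F = 1` is used).  Write `s = ⌊√n⌋ ≥ 1` and `X` for the generic matrix.
* LETTER ALPHABET `Letter n = (Fin s × (Fin n × Fin n)) ⊕ (Fin s × Fin (s+1))`, values (`letterVal`):
  `inl (b,i,j) ↦ (X^{b+1})_{ij}` (`b < s`, degree `b+1 ≤ s`) and `inr (a,r) ↦ (tr X^{a+1})^r` if
  `(a+1)·r ≤ s`, else `0` (degree `≤ s`).  `Sym_n` acts (`letterPerm`) by `(b,i,j) ↦ (b,σi,σj)` and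
  trivially on the trace letters; equivariance (`letterVal_equivariant`) is `rename_σ (X^k)_{ij} =
  (X^k)_{σi,σj}` (the generic matrix satisfies `rename_σ X = X.submatrix σ σ`) and `rename_σ tr X^k =
  tr X^k`.  WIDTH: `|Letter n| = s·n² + s·(s+1) ≤ n³ + n(n+1) ≤ (n+2)^3 ≤ (n+2)^7` for ALL `n`
  (`card_letter_le`); the alphabet is padded to `Fin ((n+2)^7)` by zero letters fixed by `Sym_n`
  (`hasStableComp_of_letters`, via `Fintype.equivOfCardEq` on `Letter n ⊕ Fin (w − |Letter n|)`).
* OUTER POLYNOMIAL.  By the companion file, `det X = G(tr X, tr X², …)` with `G` weighted-homogeneous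
  of weight `n` (`exists_isWeightedHomogeneous_aeval_trace_eq_det`).  `outerPoly` substitutes for each
  power `p_{a}^{m}` (`a = m'+1`) of a monomial of `G` the LETTER WORD `letterWord n m' m`:
  - part `a > s`: `(traceWord a)^m`, where `traceWord a = tr(L_s^{⌊a/s⌋} · L_{a mod s})` and `L_b` is
    the matrix of letters `(X^b)_{ij}` (`L_0 = 1`), a polynomial of degree `⌊a/s⌋ + 1` in the letters
    with value `tr X^a`; cost `m(⌊a/s⌋+1)`, and `s·cost ≤ 2a·m`;
  - bundled part `a ≤ s`: with `k = ⌊s/a⌋ ≥ 1`, the word `z_{a,k}^{⌊m/k⌋} · z_{a, m mod k}` in the trace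
    letters `z_{a,r} = (tr X^a)^r` (`a·k ≤ s`, `a·(m mod k) ≤ s`), value `(tr X^a)^m`, cost
    `⌊m/k⌋ + 1`, and `s·cost ≤ 2a·m + s`.
  Summing over a monomial (`Σ a·m_a = n`): `s·Σcost ≤ 2n + s²`, so with `n < (s+1)²`, `Σcost ≤ 3s+4`;
  the BOUND ACTUALLY PROVED (companion file, `sum_letterCost_le_door`) is `deg outerPoly ≤ 7s + 7`,
  matching the door dial `c = 7`: `D = 7⌊√n⌋ + 7`, `t = ⌊√n⌋`, `w = (n+2)^7`.
* REMARK (not built): brute-force expansion of `F` and the letters gives a square-symmetric homogeneous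
  depth-4 circuit of size `n^{O(√n)}` for `det_n` (det's symmetric chasm upper bound); Dawar–Pago–Seppelt
  (arXiv:2601.09343, Outlook «Symmetric depth reductions», p. 12) ask whether symmetric depth reduction
  is possible and indicate it is not in general — this is a positive INSTANCE for det, not a method.
References: [cite: DawarWilsenach2025, Thm. 7.1 (p. 18); Defs. 2.2/3.7]; Dawar–Pago–Seppelt,
arXiv:2601.09343 (Outlook p. 12); [cite: Altac2024] (Faddeev–LeVerrier, via the tree).
-/

set_option linter.dupNamespace false

noncomputable section

namespace Summit.ValiantsHypothesis.ValiantsHypothesis.Theorems.Depth4SymWidthDoor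

open MvPolynomial Literature.Computability.AlgebraicComplexity

/-- A SQUARE-SYMMETRIC (diagonally `Sym_n`-stable) composition of width `w` at degrees `(D, t)` of a
polynomial `f` on the `n × n` variable matrix: letters `Q : Fin w → ℂ[x]` of degree `≤ t` permuted by
`Sym_n` through a permutation representation `π` compatibly with the diagonal relabelling
`x_pq ↦ x_{σ p, σ q}`, and an outer `F` of degree `≤ D` with `F(Q) = f`. -/
def HasStableComp (n w D t : ℕ) (f : MvPolynomial (Fin n × Fin n) ℂ) : Prop :=
  ∃ (π : Equiv.Perm (Fin n) →* Equiv.Perm (Fin w)) (Q : Fin w → MvPolynomial (Fin n × Fin n) ℂ)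
    (F : MvPolynomial (Fin w) ℂ),
    (∀ (σ : Equiv.Perm (Fin n)) (i : Fin w),
        rename (fun pq : Fin n × Fin n => σ • pq) (Q i) = Q (π σ i)) ∧
    (∀ i, (Q i).totalDegree ≤ t) ∧ F.totalDegree ≤ D ∧ aeval Q F = f

/-- The SYMMETRIC WIDTH DOOR of a matrix family `f`: for every `c` some `f n` has NO square-symmetric
composition of width `(n+2)^c` at `(c⌊√n⌋+c, ⌊√n⌋)` (the width door of record with the alphabet
restricted to `Sym_n`-stable ones). -/
def SymWidthDoorOf (f : ∀ n : ℕ, MvPolynomial (Fin n × Fin n) ℂ) : Prop :=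
  ∀ c : ℕ, ∃ n : ℕ, ¬ HasStableComp n ((n + 2) ^ c) (c * Nat.sqrt n + c) (Nat.sqrt n) (f n)

/-- The symmetric width door for the permanent. -/
def SymWidthDoor : Prop := SymWidthDoorOf fun n => perPoly (Fin n) ℂ

/-- S4 (PROVED): the width door of record (hypothesis of `valiantsHypothesis_of_widthDoor`, verbatim)
implies the symmetric width door — a stable composition is a composition. -/
theorem symWidthDoor_of_widthDoor
    (h : ∀ c : ℕ, ∃ n : ℕ, ¬ ∃ (Q : Fin ((n + 2) ^ c) → MvPolynomial (Fin n × Fin n) ℂ)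
        (F : MvPolynomial (Fin ((n + 2) ^ c)) ℂ),
        (∀ i, (Q i).totalDegree ≤ Nat.sqrt n) ∧ F.totalDegree ≤ c * Nat.sqrt n + c ∧
          aeval Q F = perPoly (Fin n) ℂ) :
    SymWidthDoor := by
  intro c
  obtain ⟨n, hn⟩ := h c
  exact ⟨n, fun ⟨_, Q, F, _, hQ, hF, hFQ⟩ => hn ⟨Q, F, hQ, hF, hFQ⟩⟩

/-- TRANSPORT / PADDING.  A `Sym_n`-stable composition whose letters are indexed by any finite type `Λ`
with `|Λ| ≤ w` yields `HasStableComp n w D t`: identify `Λ ⊕ Fin (w − |Λ|)` with `Fin w` and pad with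
zero letters on which `Sym_n` acts trivially. -/
theorem hasStableComp_of_letters {n w D t : ℕ} {Λ : Type} [Fintype Λ]
    {f : MvPolynomial (Fin n × Fin n) ℂ} (π₀ : Equiv.Perm (Fin n) →* Equiv.Perm Λ)
    (Q₀ : Λ → MvPolynomial (Fin n × Fin n) ℂ) (F₀ : MvPolynomial Λ ℂ)
    (hQ : ∀ (σ : Equiv.Perm (Fin n)) (l : Λ),
      rename (fun pq : Fin n × Fin n => σ • pq) (Q₀ l) = Q₀ (π₀ σ l))
    (ht : ∀ l, (Q₀ l).totalDegree ≤ t) (hD : F₀.totalDegree ≤ D) (hf : aeval Q₀ F₀ = f)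
    (hw : Fintype.card Λ ≤ w) : HasStableComp n w D t f := by
  classical
  let ψ : Λ ⊕ Fin (w - Fintype.card Λ) ≃ Fin w :=
    Fintype.equivOfCardEq (by simp only [Fintype.card_sum, Fintype.card_fin]; omega)
  let Q : Fin w → MvPolynomial (Fin n × Fin n) ℂ := fun i => Sum.elim Q₀ 0 (ψ.symm i)
  have hQψ : ∀ x, Q (ψ x) = Sum.elim Q₀ 0 x := fun x => by
    show Sum.elim Q₀ 0 (ψ.symm (ψ x)) = _
    rw [Equiv.symm_apply_apply]
  let π : Equiv.Perm (Fin n) →* Equiv.Perm (Fin w) :=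
    { toFun := fun σ => ψ.permCongr (Equiv.sumCongr (π₀ σ) (Equiv.refl _))
      map_one' := by
        show ψ.permCongr (Equiv.sumCongr (π₀ 1) (Equiv.refl _)) = 1
        rw [map_one]
        ext i
        simp [Equiv.permCongr_apply]
      map_mul' := fun σ τ => by
        show ψ.permCongr (Equiv.sumCongr (π₀ (σ * τ)) (Equiv.refl _)) =
          ψ.permCongr (Equiv.sumCongr (π₀ σ) (Equiv.refl _)) *
            ψ.permCongr (Equiv.sumCongr (π₀ τ) (Equiv.refl _))
        rw [map_mul]
        ext i
        simp [Equiv.permCongr_apply, Equiv.Perm.mul_apply] }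
  have hπ : ∀ (σ : Equiv.Perm (Fin n)) (x : Λ ⊕ Fin (w - Fintype.card Λ)),
      π σ (ψ x) = ψ (Equiv.sumCongr (π₀ σ) (Equiv.refl _) x) := fun σ x => by
    show ψ.permCongr (Equiv.sumCongr (π₀ σ) (Equiv.refl _)) (ψ x) = _
    rw [Equiv.permCongr_apply, Equiv.symm_apply_apply]
  refine ⟨π, Q, rename (ψ ∘ Sum.inl) F₀, ?_, ?_, ?_, ?_⟩
  · intro σ i
    obtain ⟨x, rfl⟩ := ψ.surjective i
    rw [hπ, hQψ, hQψ]
    rcases x with l | c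
    · simpa using hQ σ l
    · simp
  · intro i
    obtain ⟨x, rfl⟩ := ψ.surjective i
    rw [hQψ]
    rcases x with l | c
    · exact ht l
    · simp
  · exact (totalDegree_rename_le _ _).trans hD
  · have hcomp : Q ∘ (ψ ∘ Sum.inl) = Q₀ := funext fun l => hQψ (Sum.inl l)
    rw [aeval_rename, hcomp, hf]

/-- The generic `n × n` matrix `X = (x_ij)`. -/
def genX (n : ℕ) : Matrix (Fin n) (Fin n) (MvPolynomial (Fin n × Fin n) ℂ) :=
  Matrix.mvPolynomialX (Fin n) (Fin n) ℂ

/-- The entries of the generic matrix are the variables. -/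
theorem genX_apply {n : ℕ} (i j : Fin n) : genX n i j = X (i, j) := rfl

/-- LETTERS (`s = ⌊√n⌋`): `inl (b, i, j)` names `(X^{b+1})_{ij}` (`b < s`); `inr (a, r)` names
`(tr X^{a+1})^r` (`a < s`, `r ≤ s`; value `0` unless `(a+1)·r ≤ s`). -/
abbrev Letter (n : ℕ) : Type :=
  (Fin (Nat.sqrt n) × (Fin n × Fin n)) ⊕ (Fin (Nat.sqrt n) × Fin (Nat.sqrt n + 1))

/-- Values of the letters (all of total degree `≤ ⌊√n⌋`). -/
def letterVal (n : ℕ) : Letter n → MvPolynomial (Fin n × Fin n) ℂ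
  | Sum.inl (b, i, j) => (genX n ^ (b.val + 1)) i j
  | Sum.inr (a, r) =>
      if (a.val + 1) * r.val ≤ Nat.sqrt n then ((genX n ^ (a.val + 1)).trace) ^ r.val else 0

/-- The permutation representation of `Sym_n` on the letters: `(b, i, j) ↦ (b, σ i, σ j)`, trace
letters fixed. -/
def letterPerm (n : ℕ) : Equiv.Perm (Fin n) →* Equiv.Perm (Letter n) where
  toFun σ := Equiv.sumCongr
    (Equiv.prodCongr (Equiv.refl (Fin (Nat.sqrt n))) (Equiv.prodCongr σ σ))
    (Equiv.refl (Fin (Nat.sqrt n) × Fin (Nat.sqrt n + 1)))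
  map_one' := by
    ext x
    rcases x with ⟨b, i, j⟩ | ⟨a, r⟩ <;> rfl
  map_mul' σ τ := by
    ext x
    rcases x with ⟨b, i, j⟩ | ⟨a, r⟩ <;> rfl

/-- The generic matrix is relabelled by `σ` into its `(σ, σ)`-submatrix. -/
theorem mapMatrix_rename_genX {n : ℕ} (σ : Equiv.Perm (Fin n)) :
    (rename (fun pq : Fin n × Fin n => σ • pq)).mapMatrix (genX n) = (genX n).submatrix σ σ := by
  ext i j
  simp only [AlgHom.mapMatrix_apply, Matrix.map_apply, genX_apply, rename_X, Matrix.submatrix_apply,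
    Prod.smul_mk, Equiv.Perm.smul_def]

/-- Equivariance of the power letters: `rename_σ (X^k)_{ij} = (X^k)_{σ i, σ j}`. -/
theorem rename_genX_pow_apply {n : ℕ} (σ : Equiv.Perm (Fin n)) (k : ℕ) (i j : Fin n) :
    rename (fun pq : Fin n × Fin n => σ • pq) ((genX n ^ k) i j) = (genX n ^ k) (σ i) (σ j) := by
  have h : (rename (fun pq : Fin n × Fin n => σ • pq)).mapMatrix (genX n ^ k) =
      (genX n ^ k).submatrix σ σ := by
    rw [map_pow, mapMatrix_rename_genX]
    induction k with
    | zero => rw [pow_zero, pow_zero, Matrix.submatrix_one_equiv]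
    | succ k ih => rw [pow_succ, pow_succ, ih, Matrix.submatrix_mul_equiv]
  have h' := congr_fun (congr_fun h i) j
  simpa only [AlgHom.mapMatrix_apply, Matrix.map_apply, Matrix.submatrix_apply] using h'

/-- Invariance of the trace letters: `rename_σ (tr X^k) = tr X^k`. -/
theorem rename_trace_genX_pow {n : ℕ} (σ : Equiv.Perm (Fin n)) (k : ℕ) :
    rename (fun pq : Fin n × Fin n => σ • pq) ((genX n ^ k).trace) = (genX n ^ k).trace := by
  simp only [Matrix.trace, Matrix.diag_apply, map_sum, rename_genX_pow_apply]
  exact Equiv.sum_comp σ (fun i => (genX n ^ k) i i)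

/-- EQUIVARIANCE of the letter alphabet under the diagonal action. -/
theorem letterVal_equivariant {n : ℕ} (σ : Equiv.Perm (Fin n)) (l : Letter n) :
    rename (fun pq : Fin n × Fin n => σ • pq) (letterVal n l) = letterVal n (letterPerm n σ l) := by
  rcases l with ⟨b, i, j⟩ | ⟨a, r⟩
  · exact rename_genX_pow_apply σ (b.val + 1) i j
  · show rename (fun pq : Fin n × Fin n => σ • pq) (letterVal n (Sum.inr (a, r))) =
      letterVal n (Sum.inr (a, r))
    simp only [letterVal]
    split_ifs with h
    · rw [map_pow, rename_trace_genX_pow]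
    · exact map_zero _

/-- Entries of `X^k` have total degree `≤ k`. -/
theorem totalDegree_genX_pow_apply_le {n : ℕ} (k : ℕ) (i j : Fin n) :
    ((genX n ^ k) i j).totalDegree ≤ k := by
  simpa using totalDegree_pow_apply_le (P := genX n) (a := 1)
    (fun i j => by rw [genX_apply]; exact (totalDegree_X _).le) k i j

/-- DEGREE of the letters: `≤ ⌊√n⌋`. -/
theorem totalDegree_letterVal_le {n : ℕ} (l : Letter n) :
    (letterVal n l).totalDegree ≤ Nat.sqrt n := by
  rcases l with ⟨b, i, j⟩ | ⟨a, r⟩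
  · show ((genX n ^ (b.val + 1)) i j).totalDegree ≤ Nat.sqrt n
    exact (totalDegree_genX_pow_apply_le (b.val + 1) i j).trans (Nat.succ_le_of_lt b.isLt)
  · simp only [letterVal]
    split_ifs with h
    · refine (totalDegree_pow _ _).trans ?_
      rw [mul_comm] at h
      exact (Nat.mul_le_mul_left _
        (totalDegree_trace_le (totalDegree_genX_pow_apply_le (a.val + 1)))).trans h
    · rw [totalDegree_zero]
      exact Nat.zero_le _

/-! ## Letter matrices, trace words, letter words, the outer polynomial -/

/-- The matrix of letters naming `X^b` (`1 ≤ b ≤ s`); the identity matrix for other `b` (used at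
`b = 0`). -/
def letterMat (n b : ℕ) : Matrix (Fin n) (Fin n) (MvPolynomial (Letter n) ℂ) :=
  Matrix.of fun i j =>
    if h : 1 ≤ b ∧ b ≤ Nat.sqrt n then X (Sum.inl (⟨b - 1, by omega⟩, (i, j)))
    else (1 : Matrix (Fin n) (Fin n) (MvPolynomial (Letter n) ℂ)) i j

/-- Substituting the letter values into `letterMat n b` gives `X^b` (`b ≤ s`). -/
theorem mapMatrix_aeval_letterMat {n b : ℕ} (hb : b ≤ Nat.sqrt n) :
    (aeval (letterVal n)).mapMatrix (letterMat n b) = genX n ^ b := by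
  ext i j
  simp only [AlgHom.mapMatrix_apply, Matrix.map_apply, letterMat, Matrix.of_apply]
  by_cases h : 1 ≤ b ∧ b ≤ Nat.sqrt n
  · simp only [dif_pos h, aeval_X, letterVal, Nat.sub_add_cancel h.1]
  · obtain rfl : b = 0 := by omega
    simp only [dif_neg h, pow_zero, Matrix.one_apply]
    split_ifs <;> simp

/-- Entries of a letter matrix have total degree `≤ 1`. -/
theorem totalDegree_letterMat_le {n : ℕ} (b : ℕ) (i j : Fin n) :
    (letterMat n b i j).totalDegree ≤ 1 := by
  simp only [letterMat, Matrix.of_apply]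
  split_ifs
  · exact (totalDegree_X _).le
  · rw [Matrix.one_apply]
    split_ifs
    · exact totalDegree_one.le.trans zero_le_one
    · exact totalDegree_zero.le.trans zero_le_one

/-- TRACE WORD for a part `a`: `tr(L_s^{⌊a/s⌋} · L_{a mod s})`, a polynomial in the power letters. -/
def traceWord (n a : ℕ) : MvPolynomial (Letter n) ℂ :=
  (letterMat n (Nat.sqrt n) ^ (a / Nat.sqrt n) * letterMat n (a % Nat.sqrt n)).trace

/-- The trace word evaluates to `tr X^a` (`n ≥ 1`). -/
theorem aeval_traceWord {n : ℕ} (hn : 1 ≤ n) (a : ℕ) :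
    aeval (letterVal n) (traceWord n a) = (genX n ^ a).trace := by
  have hs : 0 < Nat.sqrt n := Nat.sqrt_pos.2 hn
  unfold traceWord
  rw [AddMonoidHom.map_trace, ← AlgHom.mapMatrix_apply, map_mul, map_pow,
    mapMatrix_aeval_letterMat le_rfl, mapMatrix_aeval_letterMat (Nat.mod_lt a hs).le, ← pow_mul,
    ← pow_add, Nat.div_add_mod]

/-- The trace word has total degree `≤ ⌊a/s⌋ + 1`. -/
theorem totalDegree_traceWord_le {n : ℕ} (a : ℕ) :
    (traceWord n a).totalDegree ≤ a / Nat.sqrt n + 1 := by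
  unfold traceWord
  exact totalDegree_trace_le (totalDegree_mul_apply_le
    (fun i j => by
      simpa using totalDegree_pow_apply_le (totalDegree_letterMat_le (n := n) (Nat.sqrt n))
        (a / Nat.sqrt n) i j)
    (totalDegree_letterMat_le _))

/-- LETTER WORD realising `p_{m+1}^μ = (tr X^{m+1})^μ`: a power of a trace word for a part `m + 1 > s`,
a two-letter word in the bundled trace letters for `m + 1 ≤ s`. -/
def letterWord (n m μ : ℕ) : MvPolynomial (Letter n) ℂ :=
  if h : Nat.sqrt n < m + 1 then traceWord n (m + 1) ^ μ
  else
    X (Sum.inr (⟨m, by omega⟩, ⟨Nat.sqrt n / (m + 1), Nat.lt_succ_of_le (Nat.div_le_self _ _)⟩)) ^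
        (μ / (Nat.sqrt n / (m + 1))) *
      X (Sum.inr (⟨m, by omega⟩, ⟨μ % (Nat.sqrt n / (m + 1)),
        Nat.lt_succ_of_le ((Nat.mod_lt _ (Nat.div_pos (by omega) (by omega))).le.trans
          (Nat.div_le_self _ _))⟩))

/-- The letter word evaluates to `(tr X^{m+1})^μ` (`n ≥ 1`). -/
theorem aeval_letterWord {n : ℕ} (hn : 1 ≤ n) (m μ : ℕ) :
    aeval (letterVal n) (letterWord n m μ) = ((genX n ^ (m + 1)).trace) ^ μ := by
  unfold letterWord
  split_ifs with h
  · rw [map_pow, aeval_traceWord hn]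
  · have hk : 0 < Nat.sqrt n / (m + 1) := Nat.div_pos (by omega) (by omega)
    rw [map_mul, map_pow, aeval_X, aeval_X]
    simp only [letterVal]
    rw [if_pos (Nat.mul_div_le (Nat.sqrt n) (m + 1)),
      if_pos ((Nat.mul_le_mul_left (m + 1) (Nat.mod_lt μ hk).le).trans
        (Nat.mul_div_le (Nat.sqrt n) (m + 1))),
      ← pow_mul, ← pow_add, Nat.div_add_mod]

/-- DEGREE of the letter word: the cost expression of the companion file. -/
theorem totalDegree_letterWord_le {n : ℕ} (m μ : ℕ) :
    (letterWord n m μ).totalDegree ≤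
      (if Nat.sqrt n < m + 1 then μ * ((m + 1) / Nat.sqrt n + 1)
        else μ / (Nat.sqrt n / (m + 1)) + 1) := by
  unfold letterWord
  split_ifs with h
  · exact (totalDegree_pow _ _).trans (Nat.mul_le_mul_left μ (totalDegree_traceWord_le (m + 1)))
  · exact (totalDegree_mul _ _).trans (Nat.add_le_add
      ((totalDegree_pow _ _).trans (by rw [totalDegree_X, mul_one])) (totalDegree_X _).le)

/-- OUTER POLYNOMIAL: substitute the letter words into a polynomial `G ∈ ℂ[p₁, p₂, …]` monomial by
monomial. -/
def outerPoly (n : ℕ) (G : MvPolynomial ℕ ℂ) : MvPolynomial (Letter n) ℂ :=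
  ∑ d ∈ G.support, C (coeff d G) * d.prod fun m μ => letterWord n m μ

/-- The outer polynomial evaluates to `G(tr X, tr X², …)` (`n ≥ 1`). -/
theorem aeval_outerPoly {n : ℕ} (hn : 1 ≤ n) (G : MvPolynomial ℕ ℂ) :
    aeval (letterVal n) (outerPoly n G) = aeval (fun m : ℕ => (genX n ^ (m + 1)).trace) G := by
  rw [outerPoly, map_sum]
  conv_rhs => rw [G.as_sum, map_sum]
  refine Finset.sum_congr rfl fun d _ => ?_
  rw [map_mul, aeval_C, aeval_monomial, map_finsuppProd]
  simp only [aeval_letterWord hn]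

/-- DEGREE of the outer polynomial on a weight-`n` input: `≤ 7⌊√n⌋ + 7`. -/
theorem totalDegree_outerPoly_le {n : ℕ} {G : MvPolynomial ℕ ℂ}
    (hG : IsWeightedHomogeneous (fun m : ℕ => m + 1) G n) :
    (outerPoly n G).totalDegree ≤ 7 * Nat.sqrt n + 7 := by
  unfold outerPoly
  refine totalDegree_finsetSum_le fun d hd => (totalDegree_mul _ _).trans ?_
  rw [totalDegree_C, zero_add, Finsupp.prod]
  exact (totalDegree_finsetProd _ _).trans
    ((Finset.sum_le_sum fun m _ => totalDegree_letterWord_le m (d m)).trans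
      (sum_letterCost_le_door n (hG (mem_support_iff.1 hd))))

/-- WIDTH: `|Letter n| = ⌊√n⌋·n² + ⌊√n⌋(⌊√n⌋+1) ≤ (n+2)^7` for every `n`. -/
theorem card_letter_le (n : ℕ) : Fintype.card (Letter n) ≤ (n + 2) ^ 7 := by
  have hs : Nat.sqrt n ≤ n := Nat.sqrt_le_self n
  have hcard : Fintype.card (Letter n) =
      Nat.sqrt n * (n * n) + Nat.sqrt n * (Nat.sqrt n + 1) := by
    simp only [Letter, Fintype.card_sum, Fintype.card_prod, Fintype.card_fin]
  rw [hcard]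
  calc Nat.sqrt n * (n * n) + Nat.sqrt n * (Nat.sqrt n + 1)
      ≤ n * (n * n) + n * (n + 1) := by gcongr
    _ ≤ (n + 2) ^ 3 := by nlinarith [Nat.zero_le n]
    _ ≤ (n + 2) ^ 7 := Nat.pow_le_pow_right (by omega) (by norm_num)

/-- ★ S1: the DETERMINANT has a square-symmetric composition at door parameters (`c = 7`): letters
`(Xᵃ)_{ij}` and `(tr Xᵃ)^r`, `a, a·r ≤ ⌊√n⌋`, width `≤ (n+2)^7`, outer degree `≤ 7⌊√n⌋ + 7`, by the
bundled Newton–Girard expansion `det X = Σ_{λ ⊢ n} (−1)^{n−ℓ(λ)} z_λ⁻¹ Π_i tr(X^{λ_i})`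
(`n = 0`: the trivial composition). -/
theorem hasStableComp_detPoly (n : ℕ) :
    HasStableComp n ((n + 2) ^ 7) (7 * Nat.sqrt n + 7) (Nat.sqrt n) (detPoly (Fin n) ℂ) := by
  rcases Nat.eq_zero_or_pos n with rfl | hn
  · refine ⟨1, fun _ => 0, 1, fun σ i => by simp, fun i => by simp, by simp, ?_⟩
    rw [map_one, detPoly, Matrix.det_isEmpty]
  · obtain ⟨G, hGw, hGdet⟩ := exists_isWeightedHomogeneous_aeval_trace_eq_det (genX n)
    rw [Fintype.card_fin] at hGw
    exact hasStableComp_of_letters (letterPerm n) (letterVal n) (outerPoly n G)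
      (letterVal_equivariant (n := n)) (totalDegree_letterVal_le (n := n))
      (totalDegree_outerPoly_le hGw) (by rw [aeval_outerPoly hn, hGdet]; rfl) (card_letter_le n)

/-- ★ S1, door form: the symmetric width door FAILS for the determinant (at `c = 7`). -/
theorem not_symWidthDoorOf_detPoly : ¬ SymWidthDoorOf fun n => detPoly (Fin n) ℂ := by
  intro h
  obtain ⟨n, hn⟩ := h 7
  exact hn (hasStableComp_detPoly n)

end Summit.ValiantsHypothesis.ValiantsHypothesis.Theorems.Depth4SymWidthDoor

end
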